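import Literature.Geometry.Teichmuller.PennerFatgraphs
import Mathlib.Data.ZMod.QuotientGroup
import Mathlib.GroupTheory.Index
import Mathlib.Algebra.Group.End
import HarnessLib

/-!
# Regular maps from groups: the map `𝓜(G; s, t)` of a group with a rotation and an involution

A group `G` with two distinguished elements, a *rotation* `s` and an *involution* `t`
(`t * t = 1`, `t ≠ 1`), determines an oriented map `𝓜(G; s, t)` (the "algebraic map", or regular
Cayley-type map, of the theory of maps on orientable surfaces — Jones–Singerman 1978, §3; Coxeter–
Moser, *Generators and relations*, Ch. 8): the hooks (darts) are the elements of `G`, the vertex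
rotation is right multiplication by `s`, the edge involution is right multiplication by `t`, and
consequently the face (boundary-cycle) permutation `φ = σ τ` is right multiplication by `t * s`.
Vertices, edges and faces are the left cosets of `⟨s⟩`, `⟨t⟩`, `⟨t s⟩`; the map has type
`{p, q}` with `p = o(t s)` (every face a `p`-gon) and `q = o(s)` (every vertex `q`-valent), and
`#V · q = #E · 2 = #F · p = |G|`. Left translations are automorphisms and act regularly on the
darts (the map is *orientably regular*); when `s, t` generate `G` they are all of `Aut⁺`, so
`Aut⁺ 𝓜(G; s, t) ≅ G`. The dual map (vertices ↔ faces) of `𝓜(G; s, t)` is `𝓜(G; t s, t)`.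

Everything is rendered in the permutation-pair (`Fatgraph`) vocabulary of
`Literature.Geometry.Teichmuller.PennerFatgraphs` (`rot = σ`, `edgeInv = τ`, `face = σ τ`,
`numVertices / numEdges / numBoundary` = numbers of cycles, `automorphismGroup` = centralizer of
`{σ, τ}`, `IsConnected`), reading the boundary cycles of `φ` as the faces of the closed oriented
surface obtained by capping every boundary cycle with a disc. All statements here are proved;
they are the standard dictionary between regular maps and their rotation groups, used by
`Literature.Geometry.Teichmuller.BringSurfaceMaps` (the genus-4 maps of types `{5,4}` / `{4,5}`
with rotation group `S₅`).

Contents: `numCycles_mulRight_mul_orderOf` (cycles of `(· * x)` = left cosets of `⟨x⟩`),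
`minimalPeriod_mulRight`; the vocabulary additions `Fatgraph.dual`, `Fatgraph.IsOfMapType p q`,
`Fatgraph.IsOrientablyRegular`, `Fatgraph.eulerChar` (`V - E + F` of the capped surface);
`Fatgraph.ofGroup s t` = `𝓜(G; s, t)` with its face permutation, type, counts, connectedness and
`automorphismGroup` = left translations (given generation), `Fatgraph.ofGroupAutEquiv : G ≃* Aut⁺`.
Not here: reflexibility in general, Riemann–Hurwitz / uniformisation, non-regular maps.
-/

noncomputable section

open Equiv Equiv.Perm Function

namespace Literature.Geometry.Teichmuller

/-! ### Cycles of a right translation -/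

section RightTranslation

variable {G : Type*} [Group G]

/-- Every cycle of the right translation `(· * x)` has length `o(x)`: the minimal period of any
`h` under `h ↦ h * x` is `orderOf x`. [folklore] -/
theorem minimalPeriod_mulRight (x h : G) :
    minimalPeriod (Equiv.mulRight x) h = orderOf x := by
  have key : ∀ n, IsPeriodicPt (Equiv.mulRight x) n h ↔ x ^ n = 1 := by
    intro n
    rw [IsPeriodicPt, IsFixedPt, coe_mulRight, mul_right_iterate]
    exact mul_eq_left
  rw [orderOf, minimalPeriod_eq_minimalPeriod_iff]
  intro n
  rw [key, isPeriodicPt_mul_iff_pow_eq_one]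

/-- The same-cycle relation of `(· * x)` is the left-coset relation of `⟨x⟩`:
`a ~ b ↔ a⁻¹ b ∈ zpowers x`. [folklore] -/
theorem sameCycle_mulRight_iff (x a b : G) :
    SameCycle (Equiv.mulRight x) a b ↔ a⁻¹ * b ∈ Subgroup.zpowers x := by
  rw [Subgroup.mem_zpowers_iff]
  constructor
  · rintro ⟨k, hk⟩
    rw [zpow_mulRight, coe_mulRight] at hk
    exact ⟨k, by rw [← hk, inv_mul_cancel_left]⟩
  · rintro ⟨k, hk⟩
    refine ⟨k, ?_⟩
    rw [zpow_mulRight]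
    show a * x ^ k = b
    rw [hk, mul_inv_cancel_left]

variable [Fintype G] [DecidableEq G]

/-- **The cycles of a right translation are the left cosets**: the number of cycles of
`(· * x)` on a finite group `G` times `o(x)` is `|G|` (Lagrange for `⟨x⟩`). [folklore] -/
theorem numCycles_mulRight_mul_orderOf (x : G) :
    numCycles (Equiv.mulRight x) * orderOf x = Nat.card G := by
  have hrel : ∀ a b : G, (SameCycle.setoid (Equiv.mulRight x)) a b ↔
      (QuotientGroup.leftRel (Subgroup.zpowers x)) a b := by
    intro a b
    rw [QuotientGroup.leftRel_apply]
    exact sameCycle_mulRight_iff x a b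
  let e : Quotient (SameCycle.setoid (Equiv.mulRight x)) ≃ G ⧸ Subgroup.zpowers x :=
    Quotient.congrRight hrel
  rw [numCycles, ← Nat.card_eq_fintype_card, Nat.card_congr e, ← Subgroup.index_eq_card,
    ← Nat.card_zpowers x]
  exact (Subgroup.zpowers x).index_mul_card

end RightTranslation

/-! ### Small additions to the `Fatgraph` vocabulary: duality, type `{p, q}`, regularity -/

namespace Fatgraph

variable {H : Type*}

/-- Two fatgraphs on the same hooks with the same rotation and the same edge involution are
equal. [folklore] -/
theorem ext_of_rot_edgeInv {G₁ G₂ : Fatgraph H} (h₁ : G₁.rot = G₂.rot)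
    (h₂ : G₁.edgeInv = G₂.edgeInv) : G₁ = G₂ := by
  obtain ⟨r₁, e₁, _, _⟩ := G₁
  obtain ⟨r₂, e₂, _, _⟩ := G₂
  simp only at h₁ h₂
  subst h₁; subst h₂; rfl

/-- The **dual map** (vertices ↔ faces, same darts and edges): its vertex rotation is the face
permutation `φ = σ τ` of `G`, its edge involution is that of `G`; its faces are then the vertices
of `G` (`dual_face`). (This presents the Poincaré dual with the orientation convention reversed —
`φ` traverses each face with the face on one fixed side; as a map on the unoriented surface it is
the dual.) [folklore] -/
def dual (G : Fatgraph H) : Fatgraph H where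
  rot := G.face
  edgeInv := G.edgeInv
  edgeInv_edgeInv := G.edgeInv_edgeInv
  edgeInv_ne := G.edgeInv_ne

/-- The rotation of the dual is the face permutation. [folklore] -/
@[simp] theorem dual_rot (G : Fatgraph H) : G.dual.rot = G.face := rfl
/-- The dual has the same edges. [folklore] -/
@[simp] theorem dual_edgeInv (G : Fatgraph H) : G.dual.edgeInv = G.edgeInv := rfl

/-- The faces of the dual are the vertices: `φ(dual G) = (σ τ) τ = σ`. [folklore] -/
@[simp] theorem dual_face (G : Fatgraph H) : G.dual.face = G.rot := by
  ext h
  simp [face, dual, G.edgeInv_edgeInv]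

/-- The dual has the same (orientation-preserving) automorphism group: a permutation of the hooks
commutes with `σ τ` and `τ` iff it commutes with `σ` and `τ`. [folklore] -/
theorem dual_automorphismGroup (G : Fatgraph H) :
    G.dual.automorphismGroup = G.automorphismGroup := by
  ext ψ
  rw [mem_automorphismGroup, mem_automorphismGroup, dual_rot, dual_edgeInv, face]
  constructor
  · rintro ⟨h₁, h₂⟩
    refine ⟨?_, h₂⟩
    have hτ : G.edgeInv * G.edgeInv = 1 := by
      ext h; simp [G.edgeInv_edgeInv]
    calc ψ * G.rot = ψ * (G.rot * G.edgeInv) * G.edgeInv := by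
          rw [mul_assoc, mul_assoc, hτ, mul_one]
      _ = G.rot * G.edgeInv * (G.edgeInv * ψ) := by rw [h₁, mul_assoc, h₂]
      _ = G.rot * ψ := by rw [← mul_assoc, mul_assoc G.rot, hτ, mul_one]
  · rintro ⟨h₁, h₂⟩
    refine ⟨?_, h₂⟩
    rw [← mul_assoc, h₁, mul_assoc, h₂, mul_assoc]

section Counting

variable [Fintype H] [DecidableEq H]

/-- The dual exchanges the numbers of vertices and faces: `V(dual G) = F(G)`. [folklore] -/
@[simp] theorem dual_numVertices (G : Fatgraph H) : G.dual.numVertices = G.numBoundary := rfl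

/-- `F(dual G) = V(G)`. [folklore] -/
@[simp] theorem dual_numBoundary (G : Fatgraph H) : G.dual.numBoundary = G.numVertices := by
  rw [numBoundary, dual_face, numVertices]

/-- `E(dual G) = E(G)`. [folklore] -/
@[simp] theorem dual_numEdges (G : Fatgraph H) : G.dual.numEdges = G.numEdges := rfl

/-- The **Euler characteristic** `V - E + F` of the closed oriented surface of the map (every
boundary cycle of `φ` capped with a disc); `= 2 - 2g` for a connected map of genus `g`
(cf. `IsOfType g F`: `V - E = 2 - 2g - F`). [folklore] -/
def eulerChar (G : Fatgraph H) : ℤ := (G.numVertices : ℤ) - G.numEdges + G.numBoundary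

/-- Duality preserves the Euler characteristic. [folklore] -/
theorem dual_eulerChar (G : Fatgraph H) : G.dual.eulerChar = G.eulerChar := by
  simp only [eulerChar, dual_numVertices, dual_numEdges, dual_numBoundary]
  ring

/-- `IsOfType g F` (connected, `F` boundary cycles, `V - E = 2 - 2g - F`) says exactly: connected,
`F` faces and Euler characteristic `2 - 2g`. [folklore] -/
theorem isOfType_iff_eulerChar (G : Fatgraph H) (g F : ℕ) :
    G.IsOfType g F ↔ G.IsConnected ∧ G.numBoundary = F ∧ G.eulerChar = 2 - 2 * g := by
  simp only [IsOfType, eulerChar]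
  constructor <;> (rintro ⟨hc, hF, hχ⟩; refine ⟨hc, hF, ?_⟩; subst hF; omega)

end Counting

/-- **Type `{p, q}`** (Schläfli symbol of a uniform map): every face is a `p`-gon — every
boundary cycle of `φ = σ τ` has length `p` — and every vertex is `q`-valent — every cycle of `σ`
has length `q`. Cycle lengths are rendered as minimal periods. [folklore] -/
def IsOfMapType (G : Fatgraph H) (p q : ℕ) : Prop :=
  (∀ h, minimalPeriod G.face h = p) ∧ ∀ h, minimalPeriod G.rot h = q

/-- The dual of a map of type `{p, q}` has type `{q, p}`. [folklore] -/
theorem IsOfMapType.dual {G : Fatgraph H} {p q : ℕ} (h : G.IsOfMapType p q) :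
    G.dual.IsOfMapType q p :=
  ⟨fun x => by rw [dual_face]; exact h.2 x, fun x => h.1 x⟩

/-- **Orientably regular** (rotary) maps: the orientation-preserving automorphism group
(`automorphismGroup`, the centralizer of `{σ, τ}`) acts transitively on the hooks (darts). For a
connected map automorphisms act freely on darts, so the action is then regular and
`#Aut⁺ = #darts`. [folklore] -/
def IsOrientablyRegular (G : Fatgraph H) : Prop :=
  ∀ a b : H, ∃ ψ ∈ G.automorphismGroup, ψ a = b

/-- The dual of an orientably regular map is orientably regular. [folklore] -/
theorem IsOrientablyRegular.dual {G : Fatgraph H} (h : G.IsOrientablyRegular) :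
    G.dual.IsOrientablyRegular := by
  intro a b
  rw [dual_automorphismGroup]
  exact h a b

/-! ### The map `𝓜(G; s, t)` of a group with a rotation `s` and an involution `t` -/

section OfGroup

variable {G : Type*} [Group G]

/-- **The regular map `𝓜(G; s, t)`** of a group `G` with rotation `s` and involution `t`
(`t * t = 1 ≠ t`): hooks (darts) `= G`, vertex rotation `σ = (· * s)`, edge involution
`τ = (· * t)`; vertices / edges / faces are the left cosets of `⟨s⟩ / ⟨t⟩ / ⟨t s⟩`. [folklore] -/
def ofGroup (s t : G) (ht : t * t = 1) (ht₁ : t ≠ 1) : Fatgraph G where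
  rot := Equiv.mulRight s
  edgeInv := Equiv.mulRight t
  edgeInv_edgeInv h := by simp [mul_assoc, ht]
  edgeInv_ne h := by simpa [mul_eq_left] using ht₁

variable (s t : G) (ht : t * t = 1) (ht₁ : t ≠ 1)

/-- `σ = (· * s)`. [folklore] -/
@[simp] theorem ofGroup_rot : (ofGroup s t ht ht₁).rot = Equiv.mulRight s := rfl
/-- `τ = (· * t)`. [folklore] -/
@[simp] theorem ofGroup_edgeInv : (ofGroup s t ht ht₁).edgeInv = Equiv.mulRight t := rfl

/-- The face permutation of `𝓜(G; s, t)` is right multiplication by `t * s`: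
`φ h = (h t) s`. [folklore] -/
@[simp] theorem ofGroup_face : (ofGroup s t ht ht₁).face = Equiv.mulRight (t * s) := by
  rw [face, ofGroup_rot, ofGroup_edgeInv, mulRight_mul]

/-- **Duality**: the dual of `𝓜(G; s, t)` is `𝓜(G; t s, t)`. [folklore] -/
theorem ofGroup_dual : (ofGroup s t ht ht₁).dual = ofGroup (t * s) t ht ht₁ :=
  ext_of_rot_edgeInv (by rw [dual_rot, ofGroup_face, ofGroup_rot]) rfl

/-- **Type**: `𝓜(G; s, t)` has type `{o(t s), o(s)}` — every face is an `o(ts)`-gon, every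
vertex is `o(s)`-valent. [folklore] -/
theorem ofGroup_isOfMapType : (ofGroup s t ht ht₁).IsOfMapType (orderOf (t * s)) (orderOf s) :=
  ⟨fun h => by rw [ofGroup_face]; exact minimalPeriod_mulRight _ _,
    fun h => minimalPeriod_mulRight _ _⟩

/-- **Regularity**: left translations are automorphisms of `𝓜(G; s, t)` and act transitively on
the darts, so the map is orientably regular (no generation hypothesis needed). [folklore] -/
theorem ofGroup_isOrientablyRegular : (ofGroup s t ht ht₁).IsOrientablyRegular := by
  intro a b
  refine ⟨Equiv.mulLeft (b * a⁻¹), ?_, by simp⟩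
  rw [mem_automorphismGroup]
  constructor <;> (ext h; simp [mul_assoc])

/-- **Connectedness**: if `s, t` generate `G` then `𝓜(G; s, t)` is connected (the monodromy group
`⟨σ, τ⟩` contains every right translation, hence is transitive on darts). [folklore] -/
theorem ofGroup_isConnected (hgen : Subgroup.closure ({s, t} : Set G) = ⊤) :
    (ofGroup s t ht ht₁).IsConnected := by
  have hall : ∀ g : G, Equiv.mulRight g ∈
      Subgroup.closure ({Equiv.mulRight s, Equiv.mulRight t} : Set (Perm G)) := by
    intro g
    have hg : g ∈ Subgroup.closure ({s, t} : Set G) := by rw [hgen]; exact Subgroup.mem_top g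
    induction hg using Subgroup.closure_induction with
    | mem y hy =>
        apply Subgroup.subset_closure
        simp only [Set.mem_insert_iff, Set.mem_singleton_iff] at hy ⊢
        rcases hy with rfl | rfl
        · exact Or.inl rfl
        · exact Or.inr rfl
    | one => rw [mulRight_one]; exact Subgroup.one_mem _
    | mul y z _ _ hy hz => rw [mulRight_mul]; exact Subgroup.mul_mem _ hz hy
    | inv y _ hy => rw [← inv_mulRight]; exact Subgroup.inv_mem _ hy
  intro a b
  exact ⟨Equiv.mulRight (a⁻¹ * b), hall _, by simp⟩

section Aut

variable (G) in
/-- The left regular representation `g ↦ (g * ·)` as a homomorphism `G →* Perm G`. [folklore] -/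
def leftRegularHom : G →* Perm G where
  toFun g := Equiv.mulLeft g
  map_one' := mulLeft_one
  map_mul' := mulLeft_mul

/-- `leftRegularHom G g h = g * h`. [folklore] -/
@[simp] theorem leftRegularHom_apply (g h : G) : leftRegularHom G g h = g * h := rfl

variable (G) in
/-- The left regular representation is faithful. [folklore] -/
theorem leftRegularHom_injective : Function.Injective (leftRegularHom G) := by
  intro a b h
  have h1 := congrArg (fun e : Perm G => e 1) h
  simpa using h1

/-- Left translations are automorphisms of `𝓜(G; s, t)` (they commute with right translations).
[folklore] -/
theorem leftRegularHom_mem_automorphismGroup (g : G) :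
    leftRegularHom G g ∈ (ofGroup s t ht ht₁).automorphismGroup := by
  rw [mem_automorphismGroup]
  constructor <;> (ext h; simp [mul_assoc])

/-- **`Aut⁺ 𝓜(G; s, t)` = the left translations** when `s, t` generate `G`: a permutation of `G`
commuting with `(· * s)` and `(· * t)` commutes with every right translation, hence is
`h ↦ ψ(1) h`. [folklore] -/
theorem ofGroup_automorphismGroup (hgen : Subgroup.closure ({s, t} : Set G) = ⊤) :
    (ofGroup s t ht ht₁).automorphismGroup = (leftRegularHom G).range := by
  ext ψ
  constructor
  · intro hψ
    rw [mem_automorphismGroup, ofGroup_rot, ofGroup_edgeInv] at hψ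
    obtain ⟨hs, hts⟩ := hψ
    -- `ψ (h * y) = ψ h * y` for every `y` in the closure of `{s, t}`, i.e. for every `y`
    have key : ∀ y h : G, ψ (h * y) = ψ h * y := by
      intro y
      have hy : y ∈ Subgroup.closure ({s, t} : Set G) := by rw [hgen]; exact Subgroup.mem_top y
      induction hy using Subgroup.closure_induction with
      | mem z hz =>
          simp only [Set.mem_insert_iff, Set.mem_singleton_iff] at hz
          intro h
          rcases hz with rfl | rfl
          · simpa using Equiv.ext_iff.mp hs h
          · simpa using Equiv.ext_iff.mp hts h
      | one => intro h; simp
      | mul y z _ _ hy hz => intro h; rw [← mul_assoc, hz, hy, mul_assoc]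
      | inv y _ hy =>
          intro h
          have h1 := hy (h * y⁻¹)
          rw [inv_mul_cancel_right] at h1
          exact eq_mul_inv_of_mul_eq h1.symm
    rw [MonoidHom.mem_range]
    refine ⟨ψ 1, ?_⟩
    ext h
    simpa using (key h 1).symm
  · rw [MonoidHom.mem_range]
    rintro ⟨g, rfl⟩
    exact leftRegularHom_mem_automorphismGroup s t ht ht₁ g

/-- **`Aut⁺ 𝓜(G; s, t) ≅ G`** (when `s, t` generate `G`): the rotation group of the regular map
is the group. [folklore] -/
def ofGroupAutEquiv (hgen : Subgroup.closure ({s, t} : Set G) = ⊤) :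
    G ≃* (ofGroup s t ht ht₁).automorphismGroup :=
  (MonoidHom.ofInjective (leftRegularHom_injective G)).trans
    (MulEquiv.subgroupCongr (ofGroup_automorphismGroup s t ht ht₁ hgen).symm)

/-- The isomorphism sends `g` to the left translation `(g * ·)`. [folklore] -/
theorem ofGroupAutEquiv_apply (hgen : Subgroup.closure ({s, t} : Set G) = ⊤) (g h : G) :
    ((ofGroupAutEquiv s t ht ht₁ hgen g : Perm G)) h = g * h := by
  simp [ofGroupAutEquiv, MonoidHom.ofInjective_apply]

/-- `#Aut⁺ 𝓜(G; s, t) = |G|` when `s, t` generate `G`. [folklore] -/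
theorem ofGroup_numAut (hgen : Subgroup.closure ({s, t} : Set G) = ⊤) :
    (ofGroup s t ht ht₁).numAut = Nat.card G :=
  (Nat.card_congr (ofGroupAutEquiv s t ht ht₁ hgen).toEquiv).symm

end Aut

section Counting

variable [Fintype G] [DecidableEq G]

/-- `#V · o(s) = |G|`: the vertices of `𝓜(G; s, t)` are the left cosets of `⟨s⟩`. [folklore] -/
theorem ofGroup_numVertices_mul : (ofGroup s t ht ht₁).numVertices * orderOf s = Nat.card G :=
  numCycles_mulRight_mul_orderOf s

/-- `#E · 2 = |G|`: the edges are the left cosets of `⟨t⟩`, `o(t) = 2`. [folklore] -/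
theorem ofGroup_numEdges_mul : (ofGroup s t ht ht₁).numEdges * 2 = Nat.card G := by
  have h2 : orderOf t = 2 := orderOf_eq_prime (by rw [pow_two, ht]) ht₁
  rw [← h2]
  exact numCycles_mulRight_mul_orderOf t

/-- `#F · o(t s) = |G|`: the faces are the left cosets of `⟨t s⟩`. [folklore] -/
theorem ofGroup_numBoundary_mul :
    (ofGroup s t ht ht₁).numBoundary * orderOf (t * s) = Nat.card G := by
  rw [numBoundary, ofGroup_face]
  exact numCycles_mulRight_mul_orderOf (t * s)

/-- Vertex count in solved form: if `|G| = n · o(s)` then `#V = n`. [folklore] -/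
theorem ofGroup_numVertices_eq {n : ℕ} (h : Nat.card G = n * orderOf s) :
    (ofGroup s t ht ht₁).numVertices = n :=
  Nat.eq_of_mul_eq_mul_right (orderOf_pos s) ((ofGroup_numVertices_mul s t ht ht₁).trans h)

/-- Edge count in solved form: if `|G| = n · 2` then `#E = n`. [folklore] -/
theorem ofGroup_numEdges_eq {n : ℕ} (h : Nat.card G = n * 2) : (ofGroup s t ht ht₁).numEdges = n :=
  Nat.eq_of_mul_eq_mul_right two_pos ((ofGroup_numEdges_mul s t ht ht₁).trans h)

/-- Face count in solved form: if `|G| = n · o(t s)` then `#F = n`. [folklore] -/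
theorem ofGroup_numBoundary_eq {n : ℕ} (h : Nat.card G = n * orderOf (t * s)) :
    (ofGroup s t ht ht₁).numBoundary = n :=
  Nat.eq_of_mul_eq_mul_right (orderOf_pos _) ((ofGroup_numBoundary_mul s t ht ht₁).trans h)

end Counting

end OfGroup

end Fatgraph

end Literature.Geometry.Teichmuller

end
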